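import Summits.ABC.IUTFork.Repair.RHSigmaMass
import Summits.ABC.IUTFork.Cor312ThetaSidePerImageK
import HarnessLib

/-!
# R-H ROUND 2, Q1 (off-Σ error term) — IMAGE-CHOICE RIGIDITY at the genuine bed: the idele-only majorant `offImageGap P σ U` of the
# off-Σ remainder does NOT depend on the global possible image `U`; it IS the trivial off-Σ mass `B_triv(σᶜ)`

abc-iut cell, rung LADDER-ABC:A2.RESCUE.H, R-H ROUND 2 seat abc-iut-rh2-xi-2 (Q1 second hand, DATUM-strata rows 8 / 15 / 18; the off-Σ contribution as an
explicit error term). PROOF-ONLY file (0 definitions, 0 `Prop` facts), composed BY NAME from: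
* abc-iut-rh2-q2-eq `RHSigmaLicence` (p468453): `ImageChoice`-indexed majorant `offImageGap P σ U`, `offRemainder_le_offImageGap`, and the signed cell bound
  `cellDeficit_le_qLocal_sub_image` («deficit ≤ q-volume − volume of ANY possible image»);
* abc-iut-rh2-T-1 `RHSigmaMass` (p477034 + append p478609): `thetaImageChoice` (the Θ-regions as the global choice), `offTrivialMass` = `B_triv(σᶜ)`,
  `offTrivialMass_eq_offImageGap`;
* abc-iut-s2-p9 `Cor312ThetaSidePerImageK` (p459345): `logvol_eq_of_mem_possibleImages_settingPrVolSharp` — at the sharp print-normalised setting of ANY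
  Dupuy–Hilado pilot datum, for non-zero Θ-ideles, EVERY possible image in a packet is admissible with THE SAME log-volume as the sharp Kummer image
  ((Ind1)/(Ind2) act through abc-iut-c312-1's indeterminacy subgroup by VOLUME-PRESERVING maps, `Thm311.Real.adm_and_logvol_eq_of_mem_indGroup_Pr`;
  [IUTchIII] proof of Cor. 3.12 Step (x), kurims p. 181 l. 5–13 «the resulting log-volumes ∈ ℝ are invariant with respect to (Ind1), (Ind2)»);
* abc-iut-c312-7 `Cor312PilotIdelesPrProfile` / `…PrInclusion`: `logvol_thetaRegion_settingPrVolSharp_eq_sq_mul_qLocal`, `thetaRegion3_settingPrVolSharp_eq`.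

WHY THIS FILE (R-H GENERATION PASS (B), rh3-gen-2 00:38:44Z «G2-CREDIT±: is the realising image a FAT member of `possibleImages` with its own volume,
so that `cellDeficit_le_qLocal_sub_image` with `U :=` that member finances a signed credit?»). ANSWER, as kernel terms about OUR typed objects:
`Cor312.Setting.possibleImages j v_ℚ = {Φ_{j,v_ℚ}(𝒰^Θ) | Φ ∈ ⟨(Ind1) ∪ (Ind2)⟩}` — every member is a translate of the ONE region `𝒰^Θ` by a
volume-preserving packet automorphism; hence
* `logvol_imageChoice_eq` — any two global choices `U, U'` have the same log-volume in EVERY cell;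
* `logvol_imageChoice_inr_eq_sq_mul_qLocal` — for realising ideles, at a prime cell `(i+1, p)` EVERY possible image has log-volume `(i+1)²·qLocal_{i+1,p}`
  (so NO member has volume «q-volume + margin» for any margin other than the fixed pilot gap `((i+1)²−1)·qLocal ≤ 0`);
* `qLocal_sub_logvol_imageChoice_eq` — the right-hand side of `cellDeficit_le_qLocal_sub_image` is the same number for every `U`;
* **`offImageGap_eq_of_imageChoice`** — `offImageGap P♯ σ U = offImageGap P♯ σ U'` for all `U, U'`, and **`offImageGap_eq_offTrivialMass`** —
  `= B_triv(σᶜ)` (MIN-SLICE (i)'s trivial off-Σ mass); so «choose a better possible image» is an IDLE lever on the deficit side: every bound obtained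
  through the choice of image is the `t_triv` line, and any signed credit must come from the HULL term `logvol(ⁿ˚𝒰) − logvol(𝒰^Θ) ≥ 0` (rows 3/4's
  hull capacity), which is `U`-free as well.
HONEST FRAMING: equalities between OUR typed numbers at OUR typed setting; nothing here asserts that abc is proved or refuted, or that [IUTchIII] Cor. 3.12
holds or fails at any datum, and no side is taken on any author (Mochizuki / Scholze–Stix / Joshi / Dupuy–Hilado); typed ≠ proved; instantiated ≠ endorsed.
[claim: Mochizuki2012, status: disputed] for every IUT locution. [cite: Mochizuki2012, IUTchIII Cor. 3.12 p. 173–174; proof Step (x) p. 181 l. 5–13]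
[cite: DupuyHilado2025, §3.3, Thm. 3.10.1, §4.7, §4.9, §4.10]
-/

noncomputable section

open Set Function NumberField IsDedekindDomain
open scoped Pointwise

namespace Summit.ABC.IUTFork.Repair.RH.ImageGapRigid

open Summit.ABC.IUTFork.Thm311 Summit.ABC.IUTFork.Thm311.Real Summit.ABC.IUTFork.Cor312 Summit.ABC.IUTFork.Cor312.Setting
  Summit.ABC.IUTFork.Cor312Vol Summit.ABC.IUTFork.Cor312Prov Literature.IUT.LogThetaLattice Literature.IUT.LogVolume
  Literature.IUT.HodgeTheaters Literature.IUT.LogVolume.ThetaData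
  Summit.ABC.IUTFork.Repair.RH.SigmaLicence Summit.ABC.IUTFork.Repair.RH.SigmaMass

section Bed

variable {F : Type} [Field F] [NumberField F] (X : PilotData F) {logv : PadicLogs F} (hlog : LogvAnalytic logv)
  (M : Type) [Field M] [NumberField M]
  (archPk : ∀ (j : (thetaIndex X).Label) (vQ : (thetaIndex X).VQ), Set ((logShellsDH X logv).Packet j vQ))
  (archSub : ∀ (j : (thetaIndex X).Label) (v : (thetaIndex X).V),
    Set ((logShellsDH X logv).Packet j ((thetaIndex X).over v)))
  (Ψ : ℤ → ∀ v : (thetaIndex X).V, v ∈ (thetaIndex X).Vbad → Set ((logShellsDH X logv).StarPacket v))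
  (act : ℤ → ∀ v : (thetaIndex X).V, v ∈ (thetaIndex X).Vbad →
    (logShellsDH X logv).StarPacket v → Module.End ℚ ((logShellsDH X logv).StarPacket v))
  (Mmod : ℤ → ∀ j : (thetaIndex X).LabelStar, Set ((logShellsDH X logv).GlobalPacket j.1))
  (region : ℤ → ∀ j : (thetaIndex X).LabelStar, FinDivisor M → ∀ vQ : (thetaIndex X).VQ,
    Set ((logShellsDH X logv).Packet j.1 vQ))
  (n : ℤ) {HT : Type} {LogLink : HT → HT → Type} {IsFull : ∀ {s t : HT}, LogLink s t → Prop}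
  (lat : LGPGaussianLogThetaLattice LogLink IsFull)
  {Frd : Type} {IsoF : Frd → Frd → Type} {Ob : Frd → Type} {realify : Frd → Frd} {Strip : Type}
  {IsoS : Strip → Strip → Type} {Mv : ∀ v : (thetaIndex X).V, v ∈ (thetaIndex X).Vbad → Type}
  [∀ v h, Monoid (Mv v h)]
  (sig : GlobalLGPFrobenioidSignature (thetaIndex X).lstar (thetaIndex X).V (· ∈ (thetaIndex X).Vbad)
    Frd IsoF Ob realify Strip IsoS Mv)
  (split : SplittingMonoids Mv) {ObΔ : Type} {N : ∀ v : (thetaIndex X).V, v ∈ (thetaIndex X).Vbad → Type}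
  [∀ v h, Monoid (N v h)] (qData : QPilotData ObΔ N)
  (tq : ∀ (pp : Nat.Primes) (x : (thetaIndex X).Fibre (.inr pp)), haveI : Fact (pp : ℕ).Prime := ⟨pp.2⟩; kOf X pp.1 x)
  (t : ∀ (pp : Nat.Primes) (_ : Fin X.lstar) (x : (thetaIndex X).Fibre (.inr pp)),
    haveI : Fact (pp : ℕ).Prime := ⟨pp.2⟩; kOf X pp.1 x)
  (htq0 : ∀ pp x, tq pp x ≠ 0)
  (htq1 : ∀ (pp : Nat.Primes) (x : (thetaIndex X).Fibre (.inr pp)),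
    haveI : Fact (pp : ℕ).Prime := ⟨pp.2⟩; placeOf X pp.1 x ∉ X.S → ‖tq pp x‖ = 1)

/-! ## §1. Cell level: every global possible image has the volume of the Θ-regions, cell by cell -/

/-- **Any two global choices of possible images have THE SAME log-volume in every cell** `(i, v_ℚ)` of the sharp print-normalised setting (non-zero
Θ-ideles): both equal the volume of the sharp Kummer image (`logvol_eq_of_mem_possibleImages_settingPrVolSharp`: (Ind1)/(Ind2) act by volume-preserving
maps, [IUTchIII] proof of Cor. 3.12 Step (x) p. 181 l. 5–13). [cite: Mochizuki2012, IUTchIII Cor. 3.12 proof Step (x) p. 181] [claim: Mochizuki2012, status: disputed] -/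
theorem logvol_imageChoice_eq (ht0 : ∀ pp i x, t pp i x ≠ 0)
    (U U' : ImageChoice (settingPrVolSharp X hlog M archPk archSub Ψ act Mmod region n lat sig split qData tq t htq0 htq1))
    (c : Fin (thetaIndex X).lstar × (thetaIndex X).VQ) :
    ((situationPrVol X hlog M archPk archSub Ψ act Mmod region).D n).logvol (labelSucc c.1) c.2 (U.1 c) =
      ((situationPrVol X hlog M archPk archSub Ψ act Mmod region).D n).logvol (labelSucc c.1) c.2 (U'.1 c) :=
  (logvol_eq_of_mem_possibleImages_settingPrVolSharp X hlog M archPk archSub Ψ act Mmod region n lat sig split qData tq t htq0 htq1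
      ht0 _ c.2 (U.2 c)).2.trans
    (logvol_eq_of_mem_possibleImages_settingPrVolSharp X hlog M archPk archSub Ψ act Mmod region n lat sig split qData tq t htq0 htq1
      ht0 _ c.2 (U'.2 c)).2.symm

/-- **Every global possible image has, cell by cell, the log-volume of the (Ind3)-enlarged Θ-pilot region `𝒰^Θ`** (the Θ-regions being themselves a
global choice, `RH.SigmaMass.thetaImageChoice`). [cite: Mochizuki2012, IUTchIII Cor. 3.12 proof Step (x) p. 181] [claim: Mochizuki2012, status: disputed] -/
theorem logvol_imageChoice_eq_thetaRegion3 (ht0 : ∀ pp i x, t pp i x ≠ 0)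
    (U : ImageChoice (settingPrVolSharp X hlog M archPk archSub Ψ act Mmod region n lat sig split qData tq t htq0 htq1))
    (c : Fin (thetaIndex X).lstar × (thetaIndex X).VQ) :
    ((situationPrVol X hlog M archPk archSub Ψ act Mmod region).D n).logvol (labelSucc c.1) c.2 (U.1 c) =
      ((situationPrVol X hlog M archPk archSub Ψ act Mmod region).D n).logvol (labelSucc c.1) c.2
        ((settingPrVolSharp X hlog M archPk archSub Ψ act Mmod region n lat sig split qData tq t htq0 htq1).thetaRegion3 (labelSucc c.1) c.2) :=
  logvol_imageChoice_eq X hlog M archPk archSub Ψ act Mmod region n lat sig split qData tq t htq0 htq1 ht0 U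
    (thetaImageChoice (settingPrVolSharp X hlog M archPk archSub Ψ act Mmod region n lat sig split qData tq t htq0 htq1)) c

/-- **At a PRIME cell `(i+1, p)`, for REALISING Θ-ideles, EVERY possible image has log-volume `(i+1)²·qLocal_{i+1,p}`** (abc-iut-c312-7
`logvol_thetaRegion_settingPrVolSharp_eq_sq_mul_qLocal` for the Kummer image, transported by `logvol_imageChoice_eq_thetaRegion3`): NO member of
`possibleImages` has a volume other than the Θ-volume — in particular none has volume «q-volume + (margin)» for a margin other than the fixed pilot
gap `((i+1)² − 1)·qLocal_{i+1,p} ≤ 0`. [cite: DupuyHilado2025, §3.3, Thm. 3.10.1, §4.10] [claim: Mochizuki2012, status: disputed] -/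
theorem logvol_imageChoice_inr_eq_sq_mul_qLocal (ht0 : ∀ pp i x, t pp i x ≠ 0)
    (ht : ∀ (pp : Nat.Primes) (i : Fin X.lstar) (x : (thetaIndex X).Fibre (.inr pp)),
      haveI : Fact (pp : ℕ).Prime := ⟨pp.2⟩
      Real.log ‖t pp i x‖ = -(X.thetaPilot i (placeOf X pp.1 x)) * logNorm F (placeOf X pp.1 x) / localDegree F (placeOf X pp.1 x))
    (htq : ∀ (pp : Nat.Primes) (x : (thetaIndex X).Fibre (.inr pp)),
      haveI : Fact (pp : ℕ).Prime := ⟨pp.2⟩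
      Real.log ‖tq pp x‖ = -(X.qPilot (placeOf X pp.1 x)) * logNorm F (placeOf X pp.1 x) / localDegree F (placeOf X pp.1 x))
    (U : ImageChoice (settingPrVolSharp X hlog M archPk archSub Ψ act Mmod region n lat sig split qData tq t htq0 htq1))
    (i : Fin (thetaIndex X).lstar) (pp : Nat.Primes) :
    ((situationPrVol X hlog M archPk archSub Ψ act Mmod region).D n).logvol (labelSucc i) (.inr pp) (U.1 (i, .inr pp)) =
      (((i : ℕ) + 1 : ℝ) ^ 2) *
        (settingPrVolSharp X hlog M archPk archSub Ψ act Mmod region n lat sig split qData tq t htq0 htq1).qLocal (labelSucc i) (.inr pp) := by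
  rw [logvol_imageChoice_eq_thetaRegion3 X hlog M archPk archSub Ψ act Mmod region n lat sig split qData tq t htq0 htq1 ht0 U (i, .inr pp),
    thetaRegion3_settingPrVolSharp_eq X hlog M archPk archSub Ψ act Mmod region n lat sig split qData t tq htq0 htq1 0]
  exact logvol_thetaRegion_settingPrVolSharp_eq_sq_mul_qLocal X hlog M archPk archSub Ψ act Mmod region n lat sig split qData t ht0 ht tq
    htq0 htq1 htq 0 i pp

/-- **The right-hand side of q2-eq's signed cell bound `cellDeficit_le_qLocal_sub_image` is the same number for every global choice `U`**:
«q-volume − volume of the chosen possible image» = «q-volume − volume of `𝒰^Θ`» in every cell. [claim: Mochizuki2012, status: disputed] -/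
theorem qLocal_sub_logvol_imageChoice_eq (ht0 : ∀ pp i x, t pp i x ≠ 0)
    (U : ImageChoice (settingPrVolSharp X hlog M archPk archSub Ψ act Mmod region n lat sig split qData tq t htq0 htq1))
    (i : Fin (thetaIndex X).lstar) (vQ : (thetaIndex X).VQ) :
    (settingPrVolSharp X hlog M archPk archSub Ψ act Mmod region n lat sig split qData tq t htq0 htq1).qLocal (labelSucc i) vQ -
        ((situationPrVol X hlog M archPk archSub Ψ act Mmod region).D n).logvol (labelSucc i) vQ (U.1 (i, vQ)) =
      (settingPrVolSharp X hlog M archPk archSub Ψ act Mmod region n lat sig split qData tq t htq0 htq1).qLocal (labelSucc i) vQ -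
        ((situationPrVol X hlog M archPk archSub Ψ act Mmod region).D n).logvol (labelSucc i) vQ
          ((settingPrVolSharp X hlog M archPk archSub Ψ act Mmod region n lat sig split qData tq t htq0 htq1).thetaRegion3 (labelSucc i) vQ) := by
  rw [logvol_imageChoice_eq_thetaRegion3 X hlog M archPk archSub Ψ act Mmod region n lat sig split qData tq t htq0 htq1 ht0 U (i, vQ)]

/-- **The signed cell bound along ANY global choice is the bound along the Θ-regions**: for every `U`, q2-eq's `cellDeficit_le_qLocal_sub_image` yields
exactly `cellDeficit ≤ q-volume − volume(𝒰^Θ)` — the choice of image finances nothing on the deficit side. (Bridge hypotheses at the bed for realising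
ideles: abc-iut-c312-7 `bridgeHyps_settingPrVolSharp_of_ideles`.) [cite: Mochizuki2012, IUTchIII Cor. 3.12 p. 173–174] [claim: Mochizuki2012, status: disputed] -/
theorem cellDeficit_le_qLocal_sub_thetaRegion3 (ht0 : ∀ pp i x, t pp i x ≠ 0)
    (ht1 : ∀ (pp : Nat.Primes) (i : Fin X.lstar) (x : (thetaIndex X).Fibre (.inr pp)),
      haveI : Fact (pp : ℕ).Prime := ⟨pp.2⟩; placeOf X pp.1 x ∉ X.S → ‖t pp i x‖ = 1)
    (i : Fin (thetaIndex X).lstar) (vQ : (thetaIndex X).VQ) :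
    cellDeficit (settingPrVolSharp X hlog M archPk archSub Ψ act Mmod region n lat sig split qData tq t htq0 htq1) i vQ ≤
      (settingPrVolSharp X hlog M archPk archSub Ψ act Mmod region n lat sig split qData tq t htq0 htq1).qLocal (labelSucc i) vQ -
        ((situationPrVol X hlog M archPk archSub Ψ act Mmod region).D n).logvol (labelSucc i) vQ
          ((settingPrVolSharp X hlog M archPk archSub Ψ act Mmod region n lat sig split qData tq t htq0 htq1).thetaRegion3 (labelSucc i) vQ) :=
  cellDeficit_le_qLocal_sub_image
    (bridgeHyps_settingPrVolSharp_of_ideles X hlog M archPk archSub Ψ act Mmod region n lat sig split qData t tq ht0 ht1 htq0 htq1)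
    (thetaImageChoice _) i vQ

/-! ## §2. The off-Σ image gap is `U`-free and equals the trivial off-Σ mass -/

/-- **IMAGE-CHOICE RIGIDITY of the off-Σ image gap**: at the sharp print-normalised setting (non-zero Θ-ideles), for EVERY stratum `σ` and ANY two global
choices `U, U'` of possible images, `offImageGap P♯ σ U = offImageGap P♯ σ U'`. [cite: Mochizuki2012, IUTchIII Cor. 3.12 proof Step (x) p. 181]
[claim: Mochizuki2012, status: disputed] -/
theorem offImageGap_eq_of_imageChoice (ht0 : ∀ pp i x, t pp i x ≠ 0) (σ : Set (Fin (thetaIndex X).lstar × (thetaIndex X).VQ))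
    (U U' : ImageChoice (settingPrVolSharp X hlog M archPk archSub Ψ act Mmod region n lat sig split qData tq t htq0 htq1)) :
    offImageGap (settingPrVolSharp X hlog M archPk archSub Ψ act Mmod region n lat sig split qData tq t htq0 htq1) σ U =
      offImageGap (settingPrVolSharp X hlog M archPk archSub Ψ act Mmod region n lat sig split qData tq t htq0 htq1) σ U' := by
  unfold offImageGap
  congr 1
  funext i
  refine finsum_congr fun vQ => ?_
  by_cases hm : (i, vQ) ∈ σᶜ
  · rw [Set.indicator_of_mem hm, Set.indicator_of_mem hm]
    exact congrArg (fun r : ℝ => max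
      ((settingPrVolSharp X hlog M archPk archSub Ψ act Mmod region n lat sig split qData tq t htq0 htq1).qLocal (labelSucc i) vQ - r) 0)
      (logvol_imageChoice_eq X hlog M archPk archSub Ψ act Mmod region n lat sig split qData tq t htq0 htq1 ht0 U U' (i, vQ))
  · rw [Set.indicator_of_notMem hm, Set.indicator_of_notMem hm]

/-- **The off-Σ image gap along ANY global choice IS the trivial off-Σ mass `B_triv(σᶜ)`** of abc-iut-rh2-T-1's `RHSigmaMass` (the image gap along the
Θ-regions, `offTrivialMass_eq_offImageGap`) — MIN-SLICE (i)'s `(1/l⋇)·Σ_{(j,p) ∉ σ} (j²−1)·|qLocal_p|` at realising ideles. So every majorant of the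
off-Σ remainder obtained through a choice of possible image is the `t_triv` line. [cite: Mochizuki2012, IUTchIII Cor. 3.12 p. 173–174]
[claim: Mochizuki2012, status: disputed] -/
theorem offImageGap_eq_offTrivialMass (ht0 : ∀ pp i x, t pp i x ≠ 0) (σ : Set (Fin (thetaIndex X).lstar × (thetaIndex X).VQ))
    (U : ImageChoice (settingPrVolSharp X hlog M archPk archSub Ψ act Mmod region n lat sig split qData tq t htq0 htq1)) :
    offImageGap (settingPrVolSharp X hlog M archPk archSub Ψ act Mmod region n lat sig split qData tq t htq0 htq1) σ U =
      offTrivialMass (settingPrVolSharp X hlog M archPk archSub Ψ act Mmod region n lat sig split qData tq t htq0 htq1) σ := by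
  rw [offTrivialMass_eq_offImageGap]
  exact offImageGap_eq_of_imageChoice X hlog M archPk archSub Ψ act Mmod region n lat sig split qData tq t htq0 htq1 ht0 σ U _

/-- **Hence the idele-only majorant of the off-Σ remainder reads, for EVERY global choice, `R_σ ≤ B_triv(σᶜ)`** (q2-eq `offRemainder_le_offImageGap` made
`U`-free; realising ideles supply the bridge hypotheses, abc-iut-c312-7 `bridgeHyps_settingPrVolSharp_of_ideles`). [cite: Mochizuki2012, IUTchIII Cor. 3.12
p. 173–174] [claim: Mochizuki2012, status: disputed] -/
theorem offRemainder_le_offTrivialMass_of_imageChoice (ht0 : ∀ pp i x, t pp i x ≠ 0)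
    (ht1 : ∀ (pp : Nat.Primes) (i : Fin X.lstar) (x : (thetaIndex X).Fibre (.inr pp)),
      haveI : Fact (pp : ℕ).Prime := ⟨pp.2⟩; placeOf X pp.1 x ∉ X.S → ‖t pp i x‖ = 1)
    (σ : Set (Fin (thetaIndex X).lstar × (thetaIndex X).VQ))
    (U : ImageChoice (settingPrVolSharp X hlog M archPk archSub Ψ act Mmod region n lat sig split qData tq t htq0 htq1)) :
    offRemainder (settingPrVolSharp X hlog M archPk archSub Ψ act Mmod region n lat sig split qData tq t htq0 htq1) σ ≤
      offImageGap (settingPrVolSharp X hlog M archPk archSub Ψ act Mmod region n lat sig split qData tq t htq0 htq1) σ U ∧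
    offImageGap (settingPrVolSharp X hlog M archPk archSub Ψ act Mmod region n lat sig split qData tq t htq0 htq1) σ U =
      offTrivialMass (settingPrVolSharp X hlog M archPk archSub Ψ act Mmod region n lat sig split qData tq t htq0 htq1) σ :=
  ⟨offRemainder_le_offImageGap
      (bridgeHyps_settingPrVolSharp_of_ideles X hlog M archPk archSub Ψ act Mmod region n lat sig split qData t tq ht0 ht1 htq0 htq1) σ U,
    offImageGap_eq_offTrivialMass X hlog M archPk archSub Ψ act Mmod region n lat sig split qData tq t htq0 htq1 ht0 σ U⟩

end Bed

end Summit.ABC.IUTFork.Repair.RH.ImageGapRigid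

end
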